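import Summits.ResolutionOfSingularities.ResolutionOfSingularities.Theorems.FrobeniusLadderFRationalResolutionSingBlowupEntryLogRegular
import Mathlib.AlgebraicGeometry.Morphisms.UniversallyOpen
import HarnessLib

/-!
# Crux `FrobeniusLadder.FRationalResolution` (stmt-ResolutionOfSingularities-15317), line `redirect`,
# stub `stub_diagonalizableQuotientResolution` — **quasi-compact varieties whose singular points carry sharp rank-two
# log regular charts are resolved by iterating `Bl_{𝓘_{Sing}}` — no uniform measure bound needed** (design C3, the
# rank-2 stratum layer of the non-isolated case, user-facing form: `…SingBlowupEntryLogRegular` with the bound `D`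
# produced by compactness of the singular locus)

* `entry_nearby` — a sharp rank-two log regular chart at the singular point `x` (étale roof `X ←ρ— Y —j↪ Spec A`, unit
  face `0` at `j y`) serves EVERY singular point of the open `ρ(Y)` with the same measure `d`: at `x' = ρ y'` the local
  ring `A_{j y'}` is singular, hence (RAY REGULARITY `…RayRegular`) `I(𝔭, φ) ⊆ j y'`, so the unit face at `j y'` is again
  `0` and the normal form re-bases (`…FixedStratumNearby.face_zero_package`).
* **`hasResolution_of_rank_two_logRegular_charts_of_quasiCompact`** — for `X` integral, locally of finite type AND
  quasi-compact over a field: if every singular point has such a chart (of ANY measure), `X` has a resolution of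
  singularities (finite subcover of `Sing X` by the open images of the roofs — étale morphisms are open — and
  `…SingBlowupEntryLogRegular.hasResolution_of_rank_two_logRegular_charts` with `D` the maximum of the measures).

Honest label: assembly toward ONE leaf stub (no stub, crux or summit closed). No definitions, no named facts, no sorry.
[cite: Kato1994, Def. (2.1), (7.3), (10.1), (10.3), (10.4)] [cite: Liu2002, §8.3.4, (3.11)]
-/

noncomputable section

-- single-problem summit: the doubled namespace component is forced
set_option linter.dupNamespace false

open CategoryTheory CategoryTheory.Limits AlgebraicGeometry TopologicalSpace
open IsLocalRing Literature.AlgebraicGeometry.Resolution Literature.AlgebraicGeometry.Resolution.LogChart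
open Summit.ResolutionOfSingularities.ResolutionOfSingularities.Theorems.FRationalResolution

namespace Summit.ResolutionOfSingularities.ResolutionOfSingularities.Theorems.FRationalResolution.SingBlowupCover

set_option maxHeartbeats 800000 in
/-- **One chart serves every singular point of the image of its roof.** See the module docstring.
[cite: Kato1994, Def. (2.1), (7.3), (10.1), (10.3)] -/
theorem entry_nearby {k : Type} [Field k] {X : Scheme.{0}} (f : X ⟶ Spec (.of k)) [LocallyOfFiniteType f]
    {A : Type} [CommRing A] [IsNoetherianRing A] {P : AddSubmonoid (Fin 2 → ℤ)} {φ : Multiplicative P →* A}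
    {𝔭 : Ideal A} [𝔭.IsPrime] {u e : Fin 2 → ℤ} {a d : ℕ} (had : a < d) (hP : P.FG)
    (hsat : ∀ (w : Fin 2 → ℤ) (k : ℕ), 0 < k → k • w ∈ P → w ∈ P)
    (hspanP : Submodule.span ℤ (P : Set (Fin 2 → ℤ)) = ⊤)
    (hface : ∀ p : P, (p : Fin 2 → ℤ) ≠ 0 → φ (Multiplicative.ofAdd p) ∈ 𝔭)
    (hQ : ∀ w, w ∈ P ↔ ∃ g ∈ Submodule.span ℤ (faceMonoid P φ 𝔭 : Set (Fin 2 → ℤ)), ∃ m l : ℤ,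
      0 ≤ l ∧ (a : ℤ) * l ≤ (d : ℤ) * m ∧ w = g + m • u + l • e)
    (hind : ∀ g ∈ Submodule.span ℤ (faceMonoid P φ 𝔭 : Set (Fin 2 → ℤ)), ∀ m l : ℤ,
      g + m • u + l • e = 0 → m = 0 ∧ l = 0)
    (hspan : ∀ w : Fin 2 → ℤ, ∃ g ∈ Submodule.span ℤ (faceMonoid P φ 𝔭 : Set (Fin 2 → ℤ)),
      ∃ m l : ℤ, w = g + m • u + l • e)
    {Y : Scheme.{0}} (ρ : Y ⟶ X) [Etale ρ] (j : Y ⟶ Spec (.of A)) [IsOpenImmersion j] (y : Y)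
    (hjy : (j y).asIdeal = 𝔭)
    (hregY : ∀ (y' : Y) (𝔮 : Ideal A) [𝔮.IsPrime], 𝔮 ≤ (j y').asIdeal → IsLogRegularAt P φ 𝔮)
    (hx : ρ y ∉ Scheme.regularLocus X) {D : ℕ} (hdD : d ≤ D) :
    ∀ x' : X, x' ∈ Set.range ρ → x' ∉ Scheme.regularLocus X →
      ∃ (A : Type) (_ : CommRing A) (_ : IsNoetherianRing A) (P : AddSubmonoid (Fin 2 → ℤ))
          (φ : Multiplicative P →* A) (𝔭 : Ideal A) (_ : 𝔭.IsPrime) (u e : Fin 2 → ℤ) (a d : ℕ),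
          a < d ∧ d ≤ D ∧ P.FG ∧
          (∀ (w : Fin 2 → ℤ) (k : ℕ), 0 < k → k • w ∈ P → w ∈ P) ∧
          Submodule.span ℤ (P : Set (Fin 2 → ℤ)) = ⊤ ∧
          (∀ p : P, (p : Fin 2 → ℤ) ≠ 0 → φ (Multiplicative.ofAdd p) ∈ 𝔭) ∧
          (∀ w, w ∈ P ↔ ∃ g ∈ Submodule.span ℤ (faceMonoid P φ 𝔭 : Set (Fin 2 → ℤ)), ∃ m l : ℤ,
            0 ≤ l ∧ (a : ℤ) * l ≤ (d : ℤ) * m ∧ w = g + m • u + l • e) ∧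
          (∀ g ∈ Submodule.span ℤ (faceMonoid P φ 𝔭 : Set (Fin 2 → ℤ)), ∀ m l : ℤ,
            g + m • u + l • e = 0 → m = 0 ∧ l = 0) ∧
          (∀ w : Fin 2 → ℤ, ∃ g ∈ Submodule.span ℤ (faceMonoid P φ 𝔭 : Set (Fin 2 → ℤ)),
            ∃ m l : ℤ, w = g + m • u + l • e) ∧
          ∃ (Y : Scheme.{0}) (ρ : Y ⟶ X) (_ : Etale ρ) (j : Y ⟶ Spec (.of A)) (_ : IsOpenImmersion j) (y : Y),
            ρ y = x' ∧ (j y).asIdeal = 𝔭 ∧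
            (∀ (y' : Y) (𝔮 : Ideal A) [𝔮.IsPrime], 𝔮 ≤ (j y').asIdeal → IsLogRegularAt P φ 𝔮) := by
  intro x' hx' hx's
  obtain ⟨y', rfl⟩ := hx'
  haveI : IsLocallyNoetherian X := LocallyOfFiniteType.isLocallyNoetherian f
  haveI : IsLocallyNoetherian Y := LocallyOfFiniteType.isLocallyNoetherian (ρ ≫ f)
  have hreg : IsLogRegularAt P φ 𝔭 := hregY y 𝔭 (by rw [hjy])
  -- singularity transports along the roof
  have htrans : ∀ y₀ : Y, ρ y₀ ∉ Scheme.regularLocus X →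
      ¬ IsRegularLocalRing (Localization.AtPrime (j y₀).asIdeal) := by
    intro y₀ h₀ hr
    apply h₀
    rw [Scheme.mem_regularLocus, ← isRegularLocalRing_stalk_iff_of_etale ρ y₀]
    have h1 := mem_regularLocus_iff_of_flat_of_isPreimmersion j y₀
    simp only [Scheme.mem_regularLocus] at h1
    rw [h1, Summit.ResolutionOfSingularities.ResolutionOfSingularities.Theorems.AffineToGlobal.AffineSingularLocus.isRegularLocalRing_stalk_Spec_iff]
    exact hr
  have hsing𝔭 : ¬ IsRegularLocalRing (Localization.AtPrime 𝔭) := by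
    have h := htrans y hx
    have gen' : ∀ (I : Ideal A) [I.IsPrime], (j y).asIdeal = I →
        ¬ IsRegularLocalRing (Localization.AtPrime I) := by
      rintro I _ rfl; exact h
    exact gen' 𝔭 hjy
  -- at the new point: singular, hence on the fixed stratum (ray regularity)
  have hI : ideal P φ 𝔭 ≤ (j y').asIdeal := by
    by_contra hI
    apply htrans y' hx's
    obtain ⟨t, ht, ht'⟩ : ∃ t ∈ {t : A | ∃ p : P, φ (Multiplicative.ofAdd p) ∈ 𝔭 ∧ φ (Multiplicative.ofAdd p) = t},
        t ∉ (j y').asIdeal := by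
      by_contra hall
      push Not at hall
      apply hI
      rw [ideal]
      refine Ideal.span_le.2 ?_
      rintro _ ⟨p, hp, rfl⟩
      exact hall _ ⟨p, hp, rfl⟩
    obtain ⟨p, hp𝔭, rfl⟩ := ht
    have hpL : (p : Fin 2 → ℤ) ∉ Submodule.span ℤ (faceMonoid P φ 𝔭 : Set (Fin 2 → ℤ)) := by
      intro hmem
      have hp0 : (p : Fin 2 → ℤ) = 0 := ConeChartEntry.span_faceMonoid_eq_bot hface _ hmem
      have : φ (Multiplicative.ofAdd p) = 1 := by
        have hp' : p = 0 := Subtype.ext hp0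
        rw [hp', ofAdd_zero, map_one]
      rw [this] at hp𝔭
      exact (Ideal.IsPrime.ne_top inferInstance) (Ideal.eq_top_of_isUnit_mem _ hp𝔭 isUnit_one)
    exact RayRegular.isRegularLocalRing_of_monomial_unit hP hsat hspanP (by omega) hQ hind hspan (j y').asIdeal
      (hregY y' _ le_rfl) p hpL ht'
  -- re-base the unit face and the normal form at `j y'`
  obtain ⟨hface', hF, -⟩ := FixedStratumNearby.face_zero_package (𝔮 := (j y').asIdeal) hface hI
  refine ⟨A, inferInstance, inferInstance, P, φ, (j y').asIdeal, inferInstance, u, e, a, d, had, hdD, hP, hsat, hspanP,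
    hface', fun w => by rw [hF]; exact hQ w, fun g hg => hind g (by rw [← hF]; exact hg),
    fun w => by rw [hF]; exact hspan w, Y, ρ, inferInstance, j, inferInstance, y', rfl, rfl, hregY⟩

set_option maxHeartbeats 800000 in
/-- **Quasi-compact varieties with sharp rank-two log regular charts at their singular points are resolved by iterating
the blowing up of the reduced singular locus.** See the module docstring.
[cite: Kato1994, Def. (2.1), (7.3), (10.1), (10.3), (10.4)] [cite: Liu2002, §8.3.4, (3.11)] -/
theorem hasResolution_of_rank_two_logRegular_charts_of_quasiCompact {k : Type} [Field k] (X : Scheme.{0})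
    [IsIntegral X] (f : X ⟶ Spec (.of k)) [LocallyOfFiniteType f] [QuasiCompact f]
    (H : ∀ x : X, x ∉ Scheme.regularLocus X →
      ∃ (A : Type) (_ : CommRing A) (_ : IsNoetherianRing A) (P : AddSubmonoid (Fin 2 → ℤ))
          (φ : Multiplicative P →* A) (𝔭 : Ideal A) (_ : 𝔭.IsPrime) (u e : Fin 2 → ℤ) (a d : ℕ),
          a < d ∧ P.FG ∧
          (∀ (w : Fin 2 → ℤ) (k : ℕ), 0 < k → k • w ∈ P → w ∈ P) ∧
          Submodule.span ℤ (P : Set (Fin 2 → ℤ)) = ⊤ ∧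
          (∀ p : P, (p : Fin 2 → ℤ) ≠ 0 → φ (Multiplicative.ofAdd p) ∈ 𝔭) ∧
          (∀ w, w ∈ P ↔ ∃ g ∈ Submodule.span ℤ (faceMonoid P φ 𝔭 : Set (Fin 2 → ℤ)), ∃ m l : ℤ,
            0 ≤ l ∧ (a : ℤ) * l ≤ (d : ℤ) * m ∧ w = g + m • u + l • e) ∧
          (∀ g ∈ Submodule.span ℤ (faceMonoid P φ 𝔭 : Set (Fin 2 → ℤ)), ∀ m l : ℤ,
            g + m • u + l • e = 0 → m = 0 ∧ l = 0) ∧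
          (∀ w : Fin 2 → ℤ, ∃ g ∈ Submodule.span ℤ (faceMonoid P φ 𝔭 : Set (Fin 2 → ℤ)),
            ∃ m l : ℤ, w = g + m • u + l • e) ∧
          ∃ (Y : Scheme.{0}) (ρ : Y ⟶ X) (_ : Etale ρ) (j : Y ⟶ Spec (.of A)) (_ : IsOpenImmersion j) (y : Y),
            ρ y = x ∧ (j y).asIdeal = 𝔭 ∧
            (∀ (y' : Y) (𝔮 : Ideal A) [𝔮.IsPrime], 𝔮 ≤ (j y').asIdeal → IsLogRegularAt P φ 𝔮)) :
    Scheme.HasResolution X := by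
  classical
  -- for each singular point: an open neighbourhood served by one chart, with its measure
  have H' : ∀ x : X, x ∉ Scheme.regularLocus X → ∃ (V : Set X) (D : ℕ), IsOpen V ∧ x ∈ V ∧
      ∀ x' : X, x' ∈ V → x' ∉ Scheme.regularLocus X →
        ∃ (A : Type) (_ : CommRing A) (_ : IsNoetherianRing A) (P : AddSubmonoid (Fin 2 → ℤ))
            (φ : Multiplicative P →* A) (𝔭 : Ideal A) (_ : 𝔭.IsPrime) (u e : Fin 2 → ℤ) (a d : ℕ),
            a < d ∧ d ≤ D ∧ P.FG ∧
            (∀ (w : Fin 2 → ℤ) (k : ℕ), 0 < k → k • w ∈ P → w ∈ P) ∧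
            Submodule.span ℤ (P : Set (Fin 2 → ℤ)) = ⊤ ∧
            (∀ p : P, (p : Fin 2 → ℤ) ≠ 0 → φ (Multiplicative.ofAdd p) ∈ 𝔭) ∧
            (∀ w, w ∈ P ↔ ∃ g ∈ Submodule.span ℤ (faceMonoid P φ 𝔭 : Set (Fin 2 → ℤ)), ∃ m l : ℤ,
              0 ≤ l ∧ (a : ℤ) * l ≤ (d : ℤ) * m ∧ w = g + m • u + l • e) ∧
            (∀ g ∈ Submodule.span ℤ (faceMonoid P φ 𝔭 : Set (Fin 2 → ℤ)), ∀ m l : ℤ,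
              g + m • u + l • e = 0 → m = 0 ∧ l = 0) ∧
            (∀ w : Fin 2 → ℤ, ∃ g ∈ Submodule.span ℤ (faceMonoid P φ 𝔭 : Set (Fin 2 → ℤ)),
              ∃ m l : ℤ, w = g + m • u + l • e) ∧
            ∃ (Y : Scheme.{0}) (ρ : Y ⟶ X) (_ : Etale ρ) (j : Y ⟶ Spec (.of A)) (_ : IsOpenImmersion j) (y : Y),
              ρ y = x' ∧ (j y).asIdeal = 𝔭 ∧
              (∀ (y' : Y) (𝔮 : Ideal A) [𝔮.IsPrime], 𝔮 ≤ (j y').asIdeal → IsLogRegularAt P φ 𝔮) := by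
    intro x hx
    obtain ⟨A, _, _, P, φ, 𝔭, _, u, e, a, d, had, hP, hsat, hspanP, hface, hQ, hind, hspan, Y, ρ, _, j, _, y, hρy, hjy,
      hregY⟩ := H x hx
    refine ⟨Set.range ρ, d, ρ.isOpenMap.isOpen_range, ⟨y, hρy⟩, ?_⟩
    rw [← hρy] at hx
    exact entry_nearby f had hP hsat hspanP hface hQ hind hspan ρ j y hjy hregY hx le_rfl
  choose V D hVo hxV hV using H'
  -- compactness of the singular locus
  haveI : CompactSpace X := QuasiCompact.compactSpace_of_compactSpace f
  have hcomp : IsCompact (Scheme.regularLocus X)ᶜ :=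
    (isOpen_regularLocus_of_locallyOfFiniteType_field f).isClosed_compl.isCompact
  let W : {x : X // x ∉ Scheme.regularLocus X} → Set X := fun x => V x.1 x.2
  have hWo : ∀ x, IsOpen (W x) := fun x => hVo x.1 x.2
  have hcov : (Scheme.regularLocus X)ᶜ ⊆ ⋃ x, W x := fun x hx => Set.mem_iUnion.2 ⟨⟨x, hx⟩, hxV x hx⟩
  obtain ⟨t, ht⟩ := hcomp.elim_finite_subcover W hWo hcov
  refine SingBlowupEntryLogRegular.hasResolution_of_rank_two_logRegular_charts (t.sup fun x => D x.1 x.2) X f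
    fun x hx => ?_
  obtain ⟨x₀, hx₀t, hxW⟩ : ∃ x₀ ∈ t, x ∈ W x₀ := by
    have := ht hx
    simpa only [Set.mem_iUnion, exists_prop] using this
  have hle : D x₀.1 x₀.2 ≤ t.sup fun x => D x.1 x.2 := Finset.le_sup (f := fun x => D x.1 x.2) hx₀t
  obtain ⟨A, _, _, P, φ, 𝔭, _, u, e, a, d, had, hdD, hrest⟩ := hV x₀.1 x₀.2 x hxW hx
  exact ⟨A, inferInstance, inferInstance, P, φ, 𝔭, inferInstance, u, e, a, d, had, hdD.trans hle, hrest⟩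

end Summit.ResolutionOfSingularities.ResolutionOfSingularities.Theorems.FRationalResolution.SingBlowupCover

end
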